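import Summits.RiemannHypothesis.RiemannHypothesis.Theorems.WeilGroundStateMarkovPartPositiveGroundStateLsc
import Literature.NumberTheory.LFunctions.WeilOddGroundState
import HarnessLib

/-!
# Odd-sector ground states have finite energy and sit at the bottom of the closed form
# (helper for crux `OddSector.OddOneSignedWindows`, item stmt-RiemannHypothesis-17778; RH-free)

Every position-space analysis of the SIGN of an odd-sector ground state `u`
(`Literature.NumberTheory.LFunctions.IsWeilOddGroundState a u`) on the right half-window — the
content of the crux `OddOneSignedWindows` (origin layer, theta envelope, resonance transport) and of
the Barta pairing of `OddBartaFloor` — works with the Markov (pure-jump) decomposition of the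
windowed form (`Literature/NumberTheory/LFunctions/WeilMarkovQuadratic.lean`),
`Re Q(g) = P(g) + 𝓔_a(g) − M_a‖g‖₂²` (`P = weilPoleForm`, `𝓔_a = weilDirichletEnergy a`,
`M_a = weilMarkovConstant a`), applied to `u` ITSELF rather than to its smooth approximants. This
file provides the entry point, the odd twin of `WeilWindowFlowWindowLipschitz.stub_groundStateEnergy`
(route WeilWindowFlow) for the odd-sector predicate:

* `IsWeilOddGroundState.tendsto_integral_mul_of_continuous`, `.tendsto_weilPoleForm`: along any
  sequence of window test functions `gₙ → u` in `L²`, pairings with continuous weights and the pole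
  form converge;
* `IsWeilOddGroundState.finiteEnergy`: the archimedean energy density `t ↦ ρ(t) D_t(u)` is
  integrable on `(0, ∞)` and **`P(u) + 𝓔_a(u) ≤ M_a + ε_od(a)`** (`ε_od = weilOddGroundEnergy`;
  `∫|u|² = 1`): lower semicontinuity of the form along the defining minimising sequence
  (Bombieri 2000, §4, proof of Thm 3: `T[f * f̄*] ≤ lim T[f_ν * f̄_ν*]`, odd sector);
* `IsWeilOddGroundState.weilPoleForm_eq`: for the (a.e. odd) ground state the pole form is the
  attractive rank-one term `P(u) = −2|∫ u(t) sinh(t/2) dt|²`, so that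
  `𝓔_a(u) ≤ M_a + ε_od(a) + 2|∫ u sinh(t/2)|²` (`IsWeilOddGroundState.weilDirichletEnergy_le`).

Proof of `finiteEnergy`: increments `D_t(gₙ) → D_t(u)` for every jump length and Fatou in the jump
length are `WeilGroundStateMarkovPart.finiteEnergy_of_tendsto` (route WeilGroundState, reused); the
energies `𝓔_a(gₙ) = Re Q(gₙ) − P(gₙ) + M_a` converge because `Re Q(gₙ) → ε_od(a)` and
`P(gₙ) → P(u)`.

References: E. Bombieri, Rend. Mat. Acc. Lincei (9) 11 (2000), §4 Thm 3 (proof) and Thm 5 (odd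
sector); H. Yoshida (1992) §6 (6.2) (pole form by parity).
-/

noncomputable section

set_option linter.dupNamespace false

open MeasureTheory Set Filter
open scoped Topology ENNReal ComplexConjugate ArithmeticFunction.vonMangoldt

namespace Summit.RiemannHypothesis.RiemannHypothesis.Theorems.OddSector

open Literature.NumberTheory.LFunctions
open Literature.NumberTheory.LFunctions.ConnesVanSuijlekom
open Summit.RiemannHypothesis.RiemannHypothesis.Theorems.WeilGroundStateMarkovPart

/-! ### Pairings and the pole form converge along approximating sequences -/

/-- **Pairings with a fixed continuous weight converge** along any sequence of window test
functions approximating an odd-sector ground state in `L²`: `∫ gₙ w → ∫ u w` (everything lives on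
the window, where `w` is square integrable). [folklore] -/
theorem _root_.Literature.NumberTheory.LFunctions.IsWeilOddGroundState.tendsto_integral_mul_of_continuous
    {a : ℝ} {u : ℝ → ℂ} {g : ℕ → ℝ → ℂ} (h : IsWeilOddGroundState a u)
    (hg : ∀ n, IsWeilTest (g n) ∧ tsupport (g n) ⊆ Icc (-a) a)
    (hL2 : Tendsto (fun n ↦ ∫ x, ‖g n x - u x‖ ^ 2) atTop (𝓝 0)) {w : ℝ → ℂ}
    (hw : Continuous w) :
    Tendsto (fun n ↦ ∫ x, g n x * w x) atTop (𝓝 (∫ x, u x * w x)) := by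
  -- adapted from the private `tendsto_integral_mul_of_continuous` of
  -- Theorems/WeilWindowFlowWindowLipschitzStubGroundStateEnergy.lean (even-sector predicate)
  set W : ℝ → ℂ := (Icc (-a) a).indicator w with hW
  have hWm : MemLp W 2 := by
    rw [hW, memLp_indicator_iff_restrict measurableSet_Icc]
    obtain ⟨C, hC⟩ := isCompact_Icc.exists_bound_of_continuousOn hw.continuousOn
    exact MemLp.of_bound hw.aestronglyMeasurable C
      ((ae_restrict_iff' measurableSet_Icc).2 (Eventually.of_forall hC))
  have hWc : MemLp (fun x ↦ conj (W x)) 2 := memLp_conj hWm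
  have hgm : ∀ n, MemLp (g n) 2 := fun n ↦ (hg n).1.memLp_two
  have key := tendsto_integral_mul_conj_left hWc h.memLp hgm hL2
  simp only [Complex.conj_conj] at key
  have hgW : ∀ n, ∫ x, g n x * W x = ∫ x, g n x * w x := fun n ↦ by
    refine integral_congr_ae (Eventually.of_forall fun x ↦ ?_)
    by_cases hx : x ∈ Icc (-a) a
    · simp [hW, hx]
    · have h0 : g n x = 0 := image_eq_zero_of_notMem_tsupport fun h' ↦ hx ((hg n).2 h')
      simp [h0]
  have huW : ∫ x, u x * W x = ∫ x, u x * w x := by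
    refine integral_congr_ae ?_
    filter_upwards [h.ae_eq_zero_of_notMem] with x hx
    by_cases hxK : x ∈ Icc (-a) a
    · simp [hW, hxK]
    · simp [hx hxK]
  simpa only [hgW, huW] using key

/-- **The pole form converges** along any sequence of window test functions approximating an
odd-sector ground state in `L²`: `P(gₙ) → P(u)`. [folklore] -/
theorem _root_.Literature.NumberTheory.LFunctions.IsWeilOddGroundState.tendsto_weilPoleForm
    {a : ℝ} {u : ℝ → ℂ} {g : ℕ → ℝ → ℂ} (h : IsWeilOddGroundState a u)
    (hg : ∀ n, IsWeilTest (g n) ∧ tsupport (g n) ⊆ Icc (-a) a)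
    (hL2 : Tendsto (fun n ↦ ∫ x, ‖g n x - u x‖ ^ 2) atTop (𝓝 0)) :
    Tendsto (fun n ↦ weilPoleForm (g n)) atTop (𝓝 (weilPoleForm u)) := by
  unfold weilPoleForm
  have hc := h.tendsto_integral_mul_of_continuous hg hL2
    (w := fun t : ℝ ↦ (Real.cosh (t / 2) : ℂ)) (by fun_prop)
  have hs := h.tendsto_integral_mul_of_continuous hg hL2
    (w := fun t : ℝ ↦ (Real.sinh (t / 2) : ℂ)) (by fun_prop)
  exact ((hc.norm.pow 2).const_mul 2).sub ((hs.norm.pow 2).const_mul 2)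

/-! ### Finite energy and the bottom inequality -/

/-- **An odd-sector ground state has finite energy and sits at the bottom of the closed form.**
For `u` with `IsWeilOddGroundState a u`, the archimedean energy density `t ↦ ρ(t) D_t(u)`
(`ρ = weilArchDensity`, `D_t = weilIncrement`) is integrable on `(0, ∞)` and
`P(u) + 𝓔_a(u) ≤ M_a + ε_od(a)` (`∫|u|² = 1`). Lower semicontinuity of the Markov-decomposed form
along the defining odd minimising sequence: `Re Q(gₙ) → ε_od(a)`, `P(gₙ) → P(u)`, hence
`𝓔_a(gₙ) → ε_od(a) − P(u) + M_a`, and Fatou in the jump length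
(`WeilGroundStateMarkovPart.finiteEnergy_of_tendsto`).
[cite: Bombieri2000Weil, §4 Thm 3 (proof) and Thm 5] -/
theorem _root_.Literature.NumberTheory.LFunctions.IsWeilOddGroundState.finiteEnergy
    {a : ℝ} {u : ℝ → ℂ} (h : IsWeilOddGroundState a u) :
    IntegrableOn (fun t ↦ weilArchDensity t * weilIncrement u t) (Ioi 0) ∧
      weilPoleForm u + weilDirichletEnergy a u ≤ weilMarkovConstant a + weilOddGroundEnergy a := by
  obtain ⟨hu2, g, hg, hQ, hL2⟩ := (isWeilOddGroundState_iff_tendsto a u).1 h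
  have hg' : ∀ n, IsWeilTest (g n) ∧ tsupport (g n) ⊆ Icc (-a) a := fun n ↦
    ⟨(hg n).1, (hg n).2.1⟩
  have hP : Tendsto (fun n ↦ weilPoleForm (g n)) atTop (𝓝 (weilPoleForm u)) :=
    h.tendsto_weilPoleForm hg' hL2
  have hE : ∀ n, weilDirichletEnergy a (g n) =
      (weilQuadratic (g n)).re - weilPoleForm (g n) + weilMarkovConstant a := by
    intro n
    have := weilQuadratic_re_eq_weilPoleForm_add_weilDirichletEnergy_sub (hg n).1 (hg n).2.1
    rw [(hg n).2.2.2, mul_one] at this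
    linarith
  have hElim : Tendsto (fun n ↦ weilDirichletEnergy a (g n)) atTop
      (𝓝 (weilOddGroundEnergy a - weilPoleForm u + weilMarkovConstant a)) := by
    simp only [hE]
    exact (hQ.sub hP).add tendsto_const_nhds
  obtain ⟨hint, hle⟩ := finiteEnergy_of_tendsto (fun n ↦ (hg n).1) hu2 hL2 hElim
  exact ⟨hint, by linarith⟩

/-- **Registered form** (sub-goal `oddGroundState_finiteEnergy` on item stmt-RiemannHypothesis-17778):
for every window `a` and every odd-sector ground state `u` at `a`, the archimedean energy density
is integrable on `(0, ∞)` and `P(u) + 𝓔_a(u) ≤ M_a + ε_od(a)`.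
[cite: Bombieri2000Weil, §4 Thm 3 (proof) and Thm 5] -/
theorem oddGroundState_finiteEnergy :
    ∀ (a : ℝ) (u : ℝ → ℂ), IsWeilOddGroundState a u →
      IntegrableOn (fun t ↦ weilArchDensity t * weilIncrement u t) (Ioi 0) ∧
        weilPoleForm u + weilDirichletEnergy a u ≤ weilMarkovConstant a + weilOddGroundEnergy a :=
  fun _ _ h ↦ h.finiteEnergy

/-! ### The pole form of an odd-sector ground state -/

/-- The `cosh(t/2)`-moment of an a.e.-odd function vanishes. [folklore] -/
theorem integral_mul_cosh_eq_zero_of_ae_odd {u : ℝ → ℂ} (huo : ∀ᵐ t : ℝ, u (-t) = -u t) :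
    ∫ t : ℝ, u t * (Real.cosh (t / 2) : ℂ) = 0 := by
  have h1 : ∫ t : ℝ, u (-t) * (Real.cosh (-t / 2) : ℂ) = ∫ t : ℝ, u t * (Real.cosh (t / 2) : ℂ) :=
    integral_neg_eq_self (fun t ↦ u t * (Real.cosh (t / 2) : ℂ)) volume
  have h2 : ∫ t : ℝ, u (-t) * (Real.cosh (-t / 2) : ℂ) = -∫ t : ℝ, u t * (Real.cosh (t / 2) : ℂ) := by
    rw [← integral_neg]
    refine integral_congr_ae ?_
    filter_upwards [huo] with t ht
    simp only [ht, neg_div, Real.cosh_neg, neg_mul]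
  have h3 := h1.symm.trans h2
  have h4 : (2 : ℂ) * ∫ t : ℝ, u t * (Real.cosh (t / 2) : ℂ) = 0 := by linear_combination h3
  simpa using h4

/-- **The pole form of an odd-sector ground state is the attractive rank-one term**
`P(u) = −2|∫ u(t) sinh(t/2) dt|²` (`u` is odd a.e., so its `cosh`-moment vanishes).
[cite: Yoshida1992HermitianForms, §6 eq. (6.2)] -/
theorem _root_.Literature.NumberTheory.LFunctions.IsWeilOddGroundState.weilPoleForm_eq
    {a : ℝ} {u : ℝ → ℂ} (h : IsWeilOddGroundState a u) :
    weilPoleForm u = -2 * ‖∫ t : ℝ, u t * (Real.sinh (t / 2) : ℂ)‖ ^ 2 := by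
  unfold weilPoleForm
  rw [integral_mul_cosh_eq_zero_of_ae_odd h.ae_neg, norm_zero]
  ring

/-- **Energy bound for an odd-sector ground state**: `𝓔_a(u) ≤ M_a + ε_od(a) + 2|∫ u sinh(t/2)|²`
(the bottom inequality with the odd pole form moved to the right). [folklore] -/
theorem _root_.Literature.NumberTheory.LFunctions.IsWeilOddGroundState.weilDirichletEnergy_le
    {a : ℝ} {u : ℝ → ℂ} (h : IsWeilOddGroundState a u) :
    weilDirichletEnergy a u ≤ weilMarkovConstant a + weilOddGroundEnergy a +
      2 * ‖∫ t : ℝ, u t * (Real.sinh (t / 2) : ℂ)‖ ^ 2 := by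
  have h1 := h.finiteEnergy.2
  rw [h.weilPoleForm_eq] at h1
  linarith

/-- The archimedean energy of an odd-sector ground state is finite (the integrability clause of
`IsWeilOddGroundState.finiteEnergy`, for dot-notation use). [folklore] -/
theorem _root_.Literature.NumberTheory.LFunctions.IsWeilOddGroundState.integrableOn_archEnergy
    {a : ℝ} {u : ℝ → ℂ} (h : IsWeilOddGroundState a u) :
    IntegrableOn (fun t ↦ weilArchDensity t * weilIncrement u t) (Ioi 0) :=
  h.finiteEnergy.1

end Summit.RiemannHypothesis.RiemannHypothesis.Theorems.OddSector

end
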